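import Mathlib
import Summits.PneNP.PneNP.Theorems.OverlapGapAlgebraSolvableImpliesStableSectionUnitClauseFMStep

/-!
# PneNP / OverlapGapAlgebra — crux `SolvableImpliesStableSection` (stmt-PneNP-2463):
# the UNIT CLAUSE block (9/·) — pairs of unit clauses: double muting and double re-randomisation

Support for crux `stmt-PneNP-2463` (`Summit.PneNP.PneNP.Theses.OverlapGapAlgebra.SolvableImpliesStableSection`),
registered stub `stub_lowDensity` (child G).  Second moments of the number of unit clauses and the count
of CONTRADICTION pairs (two clauses unit on the same variable in the same round — kind (A) of
`sissU_violated_classify`) rest on the two-clause version of the deferred-decision step: if the distinct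
non-muted clauses `i, i'` are both unit at round `t + 1`, then against the dynamics in which BOTH are
muted (which reads neither content, and agrees with the original up to round `t + 1`) both contents are
unit-like, with the same unset variable if they were unit on the same variable; and the sum over
instances of any function of the two contents and the doubly-muted states re-randomises both contents.

* `sissU_pair_unitlike` — pointwise transfer to the double muting;
* `sissU_pair_rerandomize` — `#C² · Σ_Φ Q(Φ i, Φ i', states) = Σ_Φ Σ_{x'} Σ_x Q(x, x', states)`;
* `sissU_count_unitlike_frozen`, `sissU_count_coupled_frozen` — the frozen-trajectory counts.
All objects are hypotheses; no definitions; axioms `propext`, `Classical.choice`, `Quot.sound`.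
-/

set_option linter.dupNamespace false -- `Summit.PneNP.PneNP.…`: summit = sub-problem (D-0017)

namespace Summit.PneNP.PneNP.Theorems

open Finset
open scoped Classical

section PairStep

variable {m k n : ℕ} {R : ℕ}
  (st : Finset (Fin m) → ℕ → (Fin m → Fin k → Fin n × Bool) → Fin n → Option Bool)
  (dm : Finset (Fin m) → ℕ → (Fin m → Fin k → Fin n × Bool) → Fin n → Bool)
  (h0 : ∀ (S : Finset (Fin m)) (Φ : Fin m → Fin k → Fin n × Bool) (v : Fin n), st S 0 Φ v = none)
  (hstep : ∀ (S : Finset (Fin m)) (t : ℕ) (Φ : Fin m → Fin k → Fin n × Bool) (v : Fin n),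
    st S (t + 1) Φ v =
      if st S t Φ v = none then
        (if ∃ i : Fin m, i ∉ S ∧ ∃ j : Fin k, (Φ i j).1 = v ∧ ∀ j' : Fin k, j' ≠ j →
            st S t Φ (Φ i j').1 ≠ none ∧ st S t Φ (Φ i j').1 ≠ some (Φ i j').2
          then some (dm S t Φ v)
          else if (v : ℕ) * R / n = t then some true else none)
      else st S t Φ v)
  (hdm : ∀ (S : Finset (Fin m)) (t : ℕ) (Φ : Fin m → Fin k → Fin n × Bool) (v : Fin n) (i : Fin m)
    (j : Fin k), i ∉ S → (Φ i j).1 = v → st S t Φ v = none →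
    (∀ j' : Fin k, j' ≠ j → st S t Φ (Φ i j').1 ≠ none ∧ st S t Φ (Φ i j').1 ≠ some (Φ i j').2) →
    (∀ i' : Fin m, i' ∉ S → (∃ j₁ : Fin k, (Φ i' j₁).1 = v ∧ ∀ j' : Fin k, j' ≠ j₁ →
      st S t Φ (Φ i' j').1 ≠ none ∧ st S t Φ (Φ i' j').1 ≠ some (Φ i' j').2) → i ≤ i') →
    dm S t Φ v = (Φ i j).2)

include h0 hstep hdm in
/-- **Two unit clauses against their double muting.** If the distinct clauses `i, i' ∉ S` are unit at
round `t + 1` on the variables `v`, `v'` (muted set `S`), then against the states with muted set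
`insert i' (insert i S)`: the unit slots of `i` and `i'` carry `v`, `v'`, unset at round `t + 1`, every
other slot is set and false at round `t + 1`, and each clause has another slot still unset at round `t`. -/
theorem sissU_pair_unitlike (S : Finset (Fin m)) (t : ℕ) (Φ : Fin m → Fin k → Fin n × Bool)
    (i i' : Fin m) (hi : i ∉ S) (hi' : i' ∉ S) (hii' : i ≠ i') (v v' : Fin n)
    (hu : ∃ j : Fin k, (Φ i j).1 = v ∧ st S (t + 1) Φ v = none ∧ ∀ j' : Fin k, j' ≠ j →
      st S (t + 1) Φ (Φ i j').1 ≠ none ∧ st S (t + 1) Φ (Φ i j').1 ≠ some (Φ i j').2)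
    (hu' : ∃ j : Fin k, (Φ i' j).1 = v' ∧ st S (t + 1) Φ v' = none ∧ ∀ j' : Fin k, j' ≠ j →
      st S (t + 1) Φ (Φ i' j').1 ≠ none ∧ st S (t + 1) Φ (Φ i' j').1 ≠ some (Φ i' j').2) :
    (∃ j : Fin k, (Φ i j).1 = v ∧ st (insert i' (insert i S)) (t + 1) Φ (Φ i j).1 = none ∧
      (∀ j'' : Fin k, j'' ≠ j → st (insert i' (insert i S)) (t + 1) Φ (Φ i j'').1 ≠ none ∧
        st (insert i' (insert i S)) (t + 1) Φ (Φ i j'').1 ≠ some (Φ i j'').2) ∧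
      ∃ j' : Fin k, j' ≠ j ∧ st (insert i' (insert i S)) t Φ (Φ i j').1 = none) ∧
    (∃ j : Fin k, (Φ i' j).1 = v' ∧ st (insert i' (insert i S)) (t + 1) Φ (Φ i' j).1 = none ∧
      (∀ j'' : Fin k, j'' ≠ j → st (insert i' (insert i S)) (t + 1) Φ (Φ i' j'').1 ≠ none ∧
        st (insert i' (insert i S)) (t + 1) Φ (Φ i' j'').1 ≠ some (Φ i' j'').2) ∧
      ∃ j' : Fin k, j' ≠ j ∧ st (insert i' (insert i S)) t Φ (Φ i' j').1 = none) := by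
  -- agreement of `S` and the double muting up to round `t + 1`
  have hagree : ∀ t' : ℕ, t' ≤ t + 1 → ∀ w : Fin n, st S t' Φ w = st (insert i' (insert i S)) t' Φ w := by
    refine sissU_agree st dm h0 hstep hdm S (insert i' (insert i S))
      ((subset_insert i S).trans (subset_insert i' _)) Φ (t + 1) ?_
    intro t' ht' i₀ hi₀S' hi₀S w hw
    have hi₀ : i₀ = i ∨ i₀ = i' := by
      rcases mem_insert.mp hi₀S' with h | h
      · exact Or.inr h
      · rcases mem_insert.mp h with h' | h'
        · exact Or.inl h'
        · exact absurd h' hi₀S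
    rcases hi₀ with rfl | rfl
    · have := sissU_unit_round_unique st dm hstep S Φ i₀ hi (t + 1) t' v w hu hw
      omega
    · have := sissU_unit_round_unique st dm hstep S Φ i₀ hi' (t + 1) t' v' w hu' hw
      omega
  obtain ⟨j, hj, hv, hrest⟩ := hu
  obtain ⟨j₂, hj₂, hv', hrest'⟩ := hu'
  obtain ⟨ja, hja, hjat, -⟩ := sissU_unit_succ_new st dm hstep S t Φ i hi v j hj hv hrest
  obtain ⟨jb, hjb, hjbt, -⟩ := sissU_unit_succ_new st dm hstep S t Φ i' hi' v' j₂ hj₂ hv' hrest'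
  refine ⟨⟨j, hj, ?_, fun j'' hj'' => ?_, ja, hja, ?_⟩, ⟨j₂, hj₂, ?_, fun j'' hj'' => ?_, jb, hjb, ?_⟩⟩
  · rw [← hagree (t + 1) le_rfl, hj]; exact hv
  · rw [← hagree (t + 1) le_rfl]; exact hrest j'' hj''
  · rw [← hagree t (Nat.le_succ t)]; exact hjat
  · rw [← hagree (t + 1) le_rfl, hj₂]; exact hv'
  · rw [← hagree (t + 1) le_rfl]; exact hrest' j'' hj''
  · rw [← hagree t (Nat.le_succ t)]; exact hjbt

include h0 hstep hdm in
/-- **Double re-randomisation.** For distinct `i, i'` and any real function `Q` of two clause contents and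
a trajectory, summing `Q(Φ i, Φ i', states of the dynamics muting i and i')` over the instances
re-randomises both contents: `#C² · Σ_Φ Q(Φ i, Φ i', st_Φ) = Σ_Φ Σ_{x'} Σ_x Q(x, x', st_Φ)`. -/
theorem sissU_pair_rerandomize (S : Finset (Fin m)) (i i' : Fin m) (hii' : i ≠ i')
    (Q : (Fin k → Fin n × Bool) → (Fin k → Fin n × Bool) → (ℕ → Fin n → Option Bool) → ℝ) :
    (Fintype.card (Fin k → Fin n × Bool) : ℝ) * ((Fintype.card (Fin k → Fin n × Bool) : ℝ) *
      ∑ Φ : Fin m → Fin k → Fin n × Bool, Q (Φ i) (Φ i') (fun t' w => st (insert i' (insert i S)) t' Φ w))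
      = ∑ Φ : Fin m → Fin k → Fin n × Bool, ∑ x' : Fin k → Fin n × Bool, ∑ x : Fin k → Fin n × Bool,
          Q x x' (fun t' w => st (insert i' (insert i S)) t' Φ w) := by
  have hiS : i ∈ insert i' (insert i S) := mem_insert_of_mem (mem_insert_self i S)
  have hi'S : i' ∈ insert i' (insert i S) := mem_insert_self i' _
  -- first coordinate `i`, carrying `Φ i'` along
  have h1 := Summit.PneNP.PneNP.Cruxes.SolvableImpliesStableSection.Sketch.stub_rerandomize i
    (fun Φ : Fin m → Fin k → Fin n × Bool =>
      (Φ i', fun t' w => st (insert i' (insert i S)) t' Φ w))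
    (fun Φ c => by
      refine Prod.ext (Function.update_of_ne hii'.symm c Φ) ?_
      funext t' w
      exact sissU_indep st dm h0 hstep hdm (insert i' (insert i S)) i hiS Φ c t' w)
    (fun x p => Q x p.1 p.2)
  -- second coordinate `i'`
  have h2 := Summit.PneNP.PneNP.Cruxes.SolvableImpliesStableSection.Sketch.stub_rerandomize i'
    (fun Φ : Fin m → Fin k → Fin n × Bool => fun t' w => st (insert i' (insert i S)) t' Φ w)
    (fun Φ c => by
      funext t' w
      exact sissU_indep st dm h0 hstep hdm (insert i' (insert i S)) i' hi'S Φ c t' w)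
    (fun x' r => ∑ x : Fin k → Fin n × Bool, Q x x' r)
  simp only at h1 h2
  rw [h1, h2]

/-- **Frozen count of unit-like contents.** Against fixed states `σ` (round `t + 1`) and `σ'` (round
`t`): the contents with a slot unset in `σ`, all other slots set and false in `σ`, and some other slot
unset in `σ'`, number at most `(k² - k)·(2U)·New·Set^{k-2}`, with `U` / `Set` the unset / set variables of
`σ` and `New` the variables unset in `σ'` and set in `σ`. -/
theorem sissU_count_unitlike_frozen (σ σ' : Fin n → Option Bool) :
    ((univ : Finset (Fin k → Fin n × Bool)).filter fun x => ∃ j : Fin k, σ (x j).1 = none ∧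
        (∀ j'' : Fin k, j'' ≠ j → σ (x j'').1 ≠ none ∧ σ (x j'').1 ≠ some (x j'').2) ∧
        ∃ j' : Fin k, j' ≠ j ∧ σ' (x j').1 = none).card ≤
      (k * k - k) * ((2 * ((univ : Finset (Fin n)).filter fun w => σ w = none).card) *
        ((univ : Finset (Fin n)).filter fun w => σ' w = none ∧ σ w ≠ none).card *
        ((univ : Finset (Fin n)).filter fun w => σ w ≠ none).card ^ (k - 2)) := by
  set A : Finset (Fin n × Bool) := univ.filter fun ℓ =>
    ℓ.1 ∈ (univ : Finset (Fin n)).filter fun w => σ w = none with hA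
  set B : Finset (Fin n × Bool) := univ.filter fun ℓ => σ' ℓ.1 = none ∧ σ ℓ.1 ≠ none ∧ σ ℓ.1 ≠ some ℓ.2
    with hB
  set C : Finset (Fin n × Bool) := univ.filter fun ℓ => σ ℓ.1 ≠ none ∧ σ ℓ.1 ≠ some ℓ.2 with hC
  have hsub : ((univ : Finset (Fin k → Fin n × Bool)).filter fun x => ∃ j : Fin k, σ (x j).1 = none ∧
        (∀ j'' : Fin k, j'' ≠ j → σ (x j'').1 ≠ none ∧ σ (x j'').1 ≠ some (x j'').2) ∧
        ∃ j' : Fin k, j' ≠ j ∧ σ' (x j').1 = none) ⊆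
      (univ : Finset (Fin k → Fin n × Bool)).filter fun x => ∃ j : Fin k, x j ∈ A ∧
        (∀ j'' : Fin k, j'' ≠ j → x j'' ∈ C) ∧ ∃ j' : Fin k, j' ≠ j ∧ x j' ∈ B := by
    intro x hx
    simp only [mem_filter, mem_univ, true_and] at hx ⊢
    obtain ⟨j, hj, hC', j', hj'j, hj'⟩ := hx
    refine ⟨j, ?_, fun j'' hj'' => ?_, j', hj'j, ?_⟩
    · rw [hA]; simp only [mem_filter, mem_univ, true_and]; exact hj
    · rw [hC]; simp only [mem_filter, mem_univ, true_and]; exact hC' j'' hj''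
    · rw [hB]; simp only [mem_filter, mem_univ, true_and]; exact ⟨hj', hC' j' hj'j⟩
  have hAcard : A.card = 2 * ((univ : Finset (Fin n)).filter fun w => σ w = none).card := by
    rw [hA]; exact sissU_card_lit_on _
  have hCcard : C.card ≤ ((univ : Finset (Fin n)).filter fun w => σ w ≠ none).card := by
    refine sissU_card_falseLit_le σ C _ fun ℓ hℓ => ?_
    rw [hC, mem_filter] at hℓ
    exact ⟨by rw [mem_filter]; exact ⟨mem_univ _, hℓ.2.1⟩, hℓ.2.1, hℓ.2.2⟩
  have hBcard : B.card ≤ ((univ : Finset (Fin n)).filter fun w => σ' w = none ∧ σ w ≠ none).card := by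
    refine sissU_card_falseLit_le σ B _ fun ℓ hℓ => ?_
    rw [hB, mem_filter] at hℓ
    exact ⟨by rw [mem_filter]; exact ⟨mem_univ _, hℓ.2.1, hℓ.2.2.1⟩, hℓ.2.2.1, hℓ.2.2.2⟩
  refine (card_le_card hsub).trans ((sissU_card_unitlike_sharp (k := k) A B C).trans ?_)
  rw [← hAcard]
  exact Nat.mul_le_mul_left _ (Nat.mul_le_mul (Nat.mul_le_mul_left _ hBcard) (Nat.pow_le_pow_left hCcard _))

/-- **Frozen count of the coupled fibre.** For a fixed variable `w`, the contents `x'` having a slot `j₂`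
with `(x' j₂).1 = w`, every other slot set and false in `σ`, and some other slot unset in `σ'`, number at
most `k·(k² - k)·2·New·Set^{k-2}`. -/
theorem sissU_count_coupled_frozen (σ σ' : Fin n → Option Bool) (w : Fin n) :
    ((univ : Finset (Fin k → Fin n × Bool)).filter fun x' => ∃ j₂ : Fin k, (x' j₂).1 = w ∧
        (∀ j'' : Fin k, j'' ≠ j₂ → σ (x' j'').1 ≠ none ∧ σ (x' j'').1 ≠ some (x' j'').2) ∧
        ∃ j' : Fin k, j' ≠ j₂ ∧ σ' (x' j').1 = none).card ≤
      k * ((k * k - k) * (2 * ((univ : Finset (Fin n)).filter fun w => σ' w = none ∧ σ w ≠ none).card *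
        ((univ : Finset (Fin n)).filter fun w => σ w ≠ none).card ^ (k - 2))) := by
  set A : Finset (Fin n × Bool) := univ.filter fun ℓ => ℓ.1 = w with hA
  set B : Finset (Fin n × Bool) := univ.filter fun ℓ => σ' ℓ.1 = none ∧ σ ℓ.1 ≠ none ∧ σ ℓ.1 ≠ some ℓ.2
    with hB
  set C : Finset (Fin n × Bool) := univ.filter fun ℓ => σ ℓ.1 ≠ none ∧ σ ℓ.1 ≠ some ℓ.2 with hC
  have hsub : ((univ : Finset (Fin k → Fin n × Bool)).filter fun x' => ∃ j₂ : Fin k, (x' j₂).1 = w ∧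
        (∀ j'' : Fin k, j'' ≠ j₂ → σ (x' j'').1 ≠ none ∧ σ (x' j'').1 ≠ some (x' j'').2) ∧
        ∃ j' : Fin k, j' ≠ j₂ ∧ σ' (x' j').1 = none) ⊆
      (univ : Finset (Fin k → Fin n × Bool)).filter fun x => ∃ j : Fin k, x j ∈ A ∧
        (∀ j'' : Fin k, j'' ≠ j → x j'' ∈ C) ∧ ∃ j' : Fin k, j' ≠ j ∧ x j' ∈ B := by
    intro x hx
    simp only [mem_filter, mem_univ, true_and] at hx ⊢
    obtain ⟨j, hj, hC', j', hj'j, hj'⟩ := hx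
    refine ⟨j, ?_, fun j'' hj'' => ?_, j', hj'j, ?_⟩
    · rw [hA]; simp only [mem_filter, mem_univ, true_and]; exact hj
    · rw [hC]; simp only [mem_filter, mem_univ, true_and]; exact hC' j'' hj''
    · rw [hB]; simp only [mem_filter, mem_univ, true_and]; exact ⟨hj', hC' j' hj'j⟩
  have hAcard : A.card = 2 := by rw [hA]; exact sissU_card_lit_fibre w
  have hCcard : C.card ≤ ((univ : Finset (Fin n)).filter fun w => σ w ≠ none).card := by
    refine sissU_card_falseLit_le σ C _ fun ℓ hℓ => ?_
    rw [hC, mem_filter] at hℓ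
    exact ⟨by rw [mem_filter]; exact ⟨mem_univ _, hℓ.2.1⟩, hℓ.2.1, hℓ.2.2⟩
  have hBcard : B.card ≤ ((univ : Finset (Fin n)).filter fun w => σ' w = none ∧ σ w ≠ none).card := by
    refine sissU_card_falseLit_le σ B _ fun ℓ hℓ => ?_
    rw [hB, mem_filter] at hℓ
    exact ⟨by rw [mem_filter]; exact ⟨mem_univ _, hℓ.2.1, hℓ.2.2.1⟩, hℓ.2.2.1, hℓ.2.2.2⟩
  refine (card_le_card hsub).trans ((sissU_card_unitlike_sharp (k := k) A B C).trans ?_)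
  rw [hAcard]
  calc (k * k - k) * (2 * B.card * C.card ^ (k - 2))
      ≤ (k * k - k) * (2 * ((univ : Finset (Fin n)).filter fun w => σ' w = none ∧ σ w ≠ none).card *
          ((univ : Finset (Fin n)).filter fun w => σ w ≠ none).card ^ (k - 2)) :=
        Nat.mul_le_mul_left _ (Nat.mul_le_mul (Nat.mul_le_mul_left _ hBcard) (Nat.pow_le_pow_left hCcard _))
    _ ≤ k * ((k * k - k) * (2 * ((univ : Finset (Fin n)).filter fun w => σ' w = none ∧ σ w ≠ none).card *
          ((univ : Finset (Fin n)).filter fun w => σ w ≠ none).card ^ (k - 2))) := by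
        rcases Nat.eq_zero_or_pos k with hk | hk
        · subst hk; simp
        · exact Nat.le_mul_of_pos_left _ hk

end PairStep

end Summit.PneNP.PneNP.Theorems
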